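import Summits.HodgeConjecture.CorCM.GaloisDodecicSimpleCMSixfolds
import Summits.HodgeConjecture.HodgeConjecture.Theorems.Ring2ClassTargets
import Literature.AlgebraicGeometry.Pohlmann1968.SimpleCMAbelianVarietyPowersDivisorGenerated
import Literature.AlgebraicGeometry.ComplexMultiplication.PrincipalModelOfCMOrder
import Literature.NumberTheory.ComplexMultiplication.CMTypeDictionary
import Literature.AlgebraicGeometry.Motives.AbelianVarietySimpleOfIsogeny
import Mathlib.GroupTheory.SpecificGroups.Dihedral
import Mathlib.GroupTheory.SpecificGroups.Quaternion
import HarnessLib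

/-!
# Simple abelian sixfolds with an action of a Galois CM field of degree `12` of non-abelian (dihedral `D₆`,
# dicyclic `Dic₃`) or cyclic Galois type: the Hodge conjecture for everything isogenous to a power — intrinsic
# (binder-free) forms, the named Galois types, and the class-target displays

COR-CM (cell `pub-hodgecm2`), binder seat b04 (gen 14), count-neutral claim GALOIS-DODECIC, part IV (the binders);
capstone of parts Ia/Ib/II (`CorCM/GaloisDodecicOrderSixSubgroup`, `GaloisDodecicStabiliserLemma`,
`GaloisDodecicSimpleCMSixfolds`), in the format of the octic binders `CorCM/OcticCMFieldAutomorphismsBinders`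
(gen 13).  KERNEL ONLY: theorems, no definition, no named fact, no `sorry`.  `HC_CM` is NOT used and NOT claimed:
every statement is the Hodge conjecture for a NAMED SUB-CLASS of complex abelian varieties, UNCONDITIONAL (axioms
standard).

The type-level theorems of part II take a realisation `(A, ι, θ)` of a CM type as data.  Here they are read on a
SIMPLE complex abelian sixfold `X` with a ring homomorphism `φ : F →+* End⁰(X)` from a CM field `F` of degree `12` —
via Shimura's principal model in the isogeny class (`exists_principal_pair`, §7.1 Prop. 7) realising the CM type of
the pair (`isCMTypeRealisation_cmTypeOfPair`, §5.2), simplicity along isogenies, and the isogeny invariance of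
`B = D` / of the Hodge conjecture (van Geemen 3.7):

* **`hodgeConjectureFor_of_isIsogenous_powSucc_of_ringHom_of_isGalois_twelve`** — `F` GALOIS of degree `12` with
  Galois group non-abelian or cyclic: for every SIMPLE abelian sixfold `X` with `φ : F →+* End⁰(X)`, every complex
  abelian variety isogenous to a power `X^{N+1}` is divisor-generated and satisfies the Hodge conjecture;
* **`…_of_forall_quadratic_isReal`** — the same for ANY CM field `F` of degree `12` without imaginary quadratic
  subfield (no Galois hypothesis);
* the named Galois types: **`…_of_mulEquiv_dihedralGroup`** (`Gal(F/ℚ) ≃ D₆`, Mathlib `DihedralGroup 6`) and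
  **`…_of_mulEquiv_quaternionGroup`** (`Gal(F/ℚ) ≃ Dic₃`, Mathlib `QuaternionGroup 3`), both non-abelian by `decide`;
* the class-target displays (`Ring2.ClassTargets.HCOnClass`):
  **`hcOnClass_isIsogenous_powSucc_simpleSixfold_galoisDodecicCM`** (dimensions `6(N+1)`).

Print: [Dodson1984] §4 (p. 18), §5.3; Hazama–Murty (`B = D` on all powers of a nondegenerate CM abelian variety),
Lefschetz (1,1); the Galois-group dichotomy is parts II/III (NEW).

## References
* [Dodson1984] B. Dodson, Trans. AMS 283 (1984), §4 (p. 18), §5.3.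
* [Shimura1998] G. Shimura, *Abelian Varieties with Complex Multiplication and Modular Functions*, §5.2, §7.1
  Prop. 7, §8.2 Prop. 26.
* [vanGeemen1994HodgeAV] B. van Geemen, LNM 1594 (1994), Lemma 3.7.
* [Gordon1999HodgeAVSurvey] B. B. Gordon, Thm. 6.4, 9.4.
* [Deligne2000] P. Deligne, *The Hodge conjecture* (Clay, 2000), §1.
-/

noncomputable section

open CategoryTheory CategoryTheory.Limits NumberField

namespace Summit.HodgeConjecture.CorCM.GaloisDodecic

open Literature.NumberTheory.ComplexMultiplication
open Literature.AlgebraicGeometry Literature.AlgebraicGeometry.Motives Literature.AlgebraicGeometry.HodgeTheory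
open Literature.AlgebraicGeometry.Motives.AbelianVariety
open Literature.AlgebraicGeometry.ComplexMultiplication
open Literature.AlgebraicGeometry.Pohlmann1968
open Summit.HodgeConjecture.HodgeConjecture.Ring2.ClassTargets

variable {F : Type} [Field F] [NumberField F] [IsCMField F]

/-! ### §1 From `φ : F →+* End⁰(X)` to a nondegenerate realisation in the isogeny class -/

/-- **Principal model with a nondegenerate type (Galois case).**  For a SIMPLE abelian sixfold `X` with
`φ : F →+* End⁰(X)`, `F` a Galois CM field of degree `12` with non-abelian or cyclic Galois group: there is `X′`
isogenous to `X` realising a NONDEGENERATE CM type of `F` (Shimura's principal pair + part II).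
[cite: Shimura1998, §7.1 Prop. 7 and §5.2] [cite: Dodson1984, §4 (p. 18) and §5.3] -/
theorem exists_isIsogenous_realisation_isNondegenerate_of_isGalois_twelve [IsGalois ℚ F]
    (hF : Module.finrank ℚ F = 12) (hG : (∃ x y : F ≃ₐ[ℚ] F, x * y ≠ y * x) ∨ IsCyclic (F ≃ₐ[ℚ] F))
    {X : AbelianVariety ℂ} (hXs : X.IsSimple) (hX6 : X.dim = 6) (φ : F →+* X.endAlgebra) :
    ∃ (X' : AbelianVariety ℂ) (Φ : CMType F) (ι : 𝓞 F →+* End X')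
      (θ : F →+* Module.End ℂ (complexBetti X'.X 1)),
      IsIsogenous X X' ∧ IsCMTypeRealisation Φ X' ι θ ∧ IsNondegenerate Φ := by
  obtain ⟨X', φ', ι', hφι, f, hf⟩ := exists_principal_pair φ
  have hdim' : Module.finrank ℚ F = 2 * X'.dim := by rw [hF, ← dim_eq_of_isIsogeny hf, hX6]
  have hreal := isCMTypeRealisation_cmTypeOfPair φ' hdim' ι' hφι
  obtain ⟨s₀⟩ := (inferInstance : Nonempty (F →+* ℂ))
  exact ⟨X', _, ι', _, ⟨f, hf⟩, hreal, isNondegenerate_of_isPrimitive_of_isGalois_twelve hF hG s₀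
    ((isSimple_iff_isPrimitive hreal s₀).1 (hXs.of_isIsogeny hf))⟩

/-- **Principal model with a nondegenerate type (no imaginary quadratic subfield).**  The same for ANY CM field `F`
of degree `12` all of whose quadratic subfields are real. [cite: Shimura1998, §7.1 Prop. 7 and §5.2]
[cite: Gordon1999HodgeAVSurvey, 9.4] -/
theorem exists_isIsogenous_realisation_isNondegenerate_of_forall_quadratic_isReal (hF : Module.finrank ℚ F = 12)
    (hreal : ∀ k : IntermediateField ℚ F, Module.finrank ℚ k = 2 → ∀ τ : k →+* ℂ, ComplexEmbedding.conjugate τ = τ)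
    {X : AbelianVariety ℂ} (hXs : X.IsSimple) (hX6 : X.dim = 6) (φ : F →+* X.endAlgebra) :
    ∃ (X' : AbelianVariety ℂ) (Φ : CMType F) (ι : 𝓞 F →+* End X')
      (θ : F →+* Module.End ℂ (complexBetti X'.X 1)),
      IsIsogenous X X' ∧ IsCMTypeRealisation Φ X' ι θ ∧ IsNondegenerate Φ := by
  obtain ⟨X', φ', ι', hφι, f, hf⟩ := exists_principal_pair φ
  have hdim' : Module.finrank ℚ F = 2 * X'.dim := by rw [hF, ← dim_eq_of_isIsogeny hf, hX6]
  have hreal' := isCMTypeRealisation_cmTypeOfPair φ' hdim' ι' hφι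
  obtain ⟨s₀⟩ := (inferInstance : Nonempty (F →+* ℂ))
  exact ⟨X', _, ι', _, ⟨f, hf⟩, hreal', isNondegenerate_of_isPrimitive_of_forall_quadratic_isReal hF hreal s₀
    ((isSimple_iff_isPrimitive hreal' s₀).1 (hXs.of_isIsogeny hf))⟩

/-! ### §2 `B = D` and the Hodge conjecture for everything isogenous to a power of `X` -/

/-- **`B = D` for every complex abelian variety isogenous to a power `X^{N+1}`** of a simple abelian sixfold `X`
with `φ : F →+* End⁰(X)`, `F` Galois CM of degree `12` with non-abelian or cyclic Galois group (Hazama–Murty via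
nondegeneracy; isogeny invariance of `B = D`). [cite: Gordon1999HodgeAVSurvey, Thm. 6.4 and 9.4]
[cite: vanGeemen1994HodgeAV, Lemma 3.7] -/
theorem isDivisorGenerated_of_isIsogenous_powSucc_of_ringHom_of_isGalois_twelve [IsGalois ℚ F]
    (hF : Module.finrank ℚ F = 12) (hG : (∃ x y : F ≃ₐ[ℚ] F, x * y ≠ y * x) ∨ IsCyclic (F ≃ₐ[ℚ] F))
    {X : AbelianVariety ℂ} (hXs : X.IsSimple) (hX6 : X.dim = 6) (φ : F →+* X.endAlgebra)
    {B : AbelianVariety ℂ} {N : ℕ} (h : IsIsogenous B (X.powSucc N)) : IsDivisorGenerated B := by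
  obtain ⟨X', Φ, ι, θ, hXX', hreal, hΦ⟩ :=
    exists_isIsogenous_realisation_isNondegenerate_of_isGalois_twelve hF hG hXs hX6 φ
  exact hΦ.isDivisorGenerated_of_isIsogenous_powSucc hreal (h.trans (isIsogenous_powSucc hXX' N))

/-- **The Hodge conjecture for every complex abelian variety isogenous to a power `X^{N+1}` of a SIMPLE abelian
sixfold `X` carrying an action `φ : F →+* End⁰(X)` of a GALOIS CM field `F` of degree `12` whose Galois group is
NON-ABELIAN or CYCLIC** — UNCONDITIONALLY. [cite: Dodson1984, §4 (p. 18) and §5.3]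
[cite: Gordon1999HodgeAVSurvey, Thm. 6.4] [cite: vanGeemen1994HodgeAV, Lemma 3.7] [cite: Deligne2000, §1] -/
theorem hodgeConjectureFor_of_isIsogenous_powSucc_of_ringHom_of_isGalois_twelve [IsGalois ℚ F]
    (hF : Module.finrank ℚ F = 12) (hG : (∃ x y : F ≃ₐ[ℚ] F, x * y ≠ y * x) ∨ IsCyclic (F ≃ₐ[ℚ] F))
    {X : AbelianVariety ℂ} (hXs : X.IsSimple) (hX6 : X.dim = 6) (φ : F →+* X.endAlgebra)
    {B : AbelianVariety ℂ} {N : ℕ} (h : IsIsogenous B (X.powSucc N)) : HodgeConjectureFor B.dim B.X :=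
  hodgeConjectureFor_of_isDivisorGenerated _
    (isDivisorGenerated_of_isIsogenous_powSucc_of_ringHom_of_isGalois_twelve hF hG hXs hX6 φ h)

/-- **The Hodge conjecture for every complex abelian variety isogenous to a power `X^{N+1}` of a SIMPLE abelian
sixfold `X` carrying an action `φ : F →+* End⁰(X)` of a CM field `F` of degree `12` WITHOUT imaginary quadratic
subfield** (no Galois hypothesis) — UNCONDITIONALLY. [cite: Gordon1999HodgeAVSurvey, Thm. 6.4 and 9.4]
[cite: vanGeemen1994HodgeAV, Lemma 3.7] [cite: Deligne2000, §1] -/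
theorem hodgeConjectureFor_of_isIsogenous_powSucc_of_ringHom_of_forall_quadratic_isReal
    (hF : Module.finrank ℚ F = 12)
    (hreal : ∀ k : IntermediateField ℚ F, Module.finrank ℚ k = 2 → ∀ τ : k →+* ℂ, ComplexEmbedding.conjugate τ = τ)
    {X : AbelianVariety ℂ} (hXs : X.IsSimple) (hX6 : X.dim = 6) (φ : F →+* X.endAlgebra)
    {B : AbelianVariety ℂ} {N : ℕ} (h : IsIsogenous B (X.powSucc N)) : HodgeConjectureFor B.dim B.X := by
  obtain ⟨X', Φ, ι, θ, hXX', hreal', hΦ⟩ :=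
    exists_isIsogenous_realisation_isNondegenerate_of_forall_quadratic_isReal hF hreal hXs hX6 φ
  exact hodgeConjectureFor_of_isDivisorGenerated _
    (hΦ.isDivisorGenerated_of_isIsogenous_powSucc hreal' (h.trans (isIsogenous_powSucc hXX' N)))

/-- The variety itself (`N = 0`, `B = X`): **the Hodge conjecture for every simple abelian sixfold with an action
of a Galois CM field of degree `12` of non-abelian or cyclic Galois type.** [cite: Dodson1984, §4 (p. 18) and §5.3]
[cite: Deligne2000, §1] -/
theorem hodgeConjectureFor_of_ringHom_of_isGalois_twelve [IsGalois ℚ F] (hF : Module.finrank ℚ F = 12)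
    (hG : (∃ x y : F ≃ₐ[ℚ] F, x * y ≠ y * x) ∨ IsCyclic (F ≃ₐ[ℚ] F))
    {X : AbelianVariety ℂ} (hXs : X.IsSimple) (hX6 : X.dim = 6) (φ : F →+* X.endAlgebra) :
    HodgeConjectureFor X.dim X.X :=
  hodgeConjectureFor_of_isIsogenous_powSucc_of_ringHom_of_isGalois_twelve hF hG hXs hX6 φ (N := 0)
    (IsIsogenous.refl X)

/-! ### §3 The named Galois types: dihedral `D₆` and dicyclic `Dic₃` -/

/-- A Galois group isomorphic to the dihedral group `D₆` (order `12`; Mathlib `DihedralGroup 6`) has two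
non-commuting elements (`r · s ≠ s · r`, decided). [folklore] -/
theorem exists_not_comm_of_mulEquiv_dihedralGroup {G : Type*} [Group G] (e : G ≃* DihedralGroup 6) :
    ∃ x y : G, x * y ≠ y * x := by
  refine ⟨e.symm (DihedralGroup.r 1), e.symm (DihedralGroup.sr 0), fun h => ?_⟩
  have h' := congrArg e h
  rw [map_mul, map_mul, MulEquiv.apply_symm_apply, MulEquiv.apply_symm_apply] at h'
  exact absurd h' (by decide)

/-- A Galois group isomorphic to the dicyclic group `Dic₃` (order `12`; Mathlib `QuaternionGroup 3`) has two
non-commuting elements (`a · x ≠ x · a`, decided). [folklore] -/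
theorem exists_not_comm_of_mulEquiv_quaternionGroup {G : Type*} [Group G] (e : G ≃* QuaternionGroup 3) :
    ∃ x y : G, x * y ≠ y * x := by
  refine ⟨e.symm (QuaternionGroup.a 1), e.symm (QuaternionGroup.xa 0), fun h => ?_⟩
  have h' := congrArg e h
  rw [map_mul, map_mul, MulEquiv.apply_symm_apply, MulEquiv.apply_symm_apply] at h'
  exact absurd h' (by decide)

/-- **Dihedral type `D₆`.**  The Hodge conjecture for every complex abelian variety isogenous to a power of a simple
abelian sixfold with an action of a CM field `F` of degree `12` whose Galois group is the dihedral group of order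
`12` (the Galois closures of the non-Galois "`D₆`-sextic" CM fields; Dodson's partition `64 = 4 + 12 + 12 + 12 + 24`)
— UNCONDITIONALLY. [cite: Dodson1984, §4 (p. 18)] [cite: Deligne2000, §1] -/
theorem hodgeConjectureFor_of_isIsogenous_powSucc_of_mulEquiv_dihedralGroup [IsGalois ℚ F]
    (hF : Module.finrank ℚ F = 12) (e : (F ≃ₐ[ℚ] F) ≃* DihedralGroup 6)
    {X : AbelianVariety ℂ} (hXs : X.IsSimple) (hX6 : X.dim = 6) (φ : F →+* X.endAlgebra)
    {B : AbelianVariety ℂ} {N : ℕ} (h : IsIsogenous B (X.powSucc N)) : HodgeConjectureFor B.dim B.X :=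
  hodgeConjectureFor_of_isIsogenous_powSucc_of_ringHom_of_isGalois_twelve hF
    (Or.inl (exists_not_comm_of_mulEquiv_dihedralGroup e)) hXs hX6 φ h

/-- **Dicyclic type `Dic₃`.**  The Hodge conjecture for every complex abelian variety isogenous to a power of a
simple abelian sixfold with an action of a CM field `F` of degree `12` whose Galois group is the dicyclic group of
order `12` — UNCONDITIONALLY. [cite: Dodson1984, §5.3] [cite: Deligne2000, §1] -/
theorem hodgeConjectureFor_of_isIsogenous_powSucc_of_mulEquiv_quaternionGroup [IsGalois ℚ F]
    (hF : Module.finrank ℚ F = 12) (e : (F ≃ₐ[ℚ] F) ≃* QuaternionGroup 3)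
    {X : AbelianVariety ℂ} (hXs : X.IsSimple) (hX6 : X.dim = 6) (φ : F →+* X.endAlgebra)
    {B : AbelianVariety ℂ} {N : ℕ} (h : IsIsogenous B (X.powSucc N)) : HodgeConjectureFor B.dim B.X :=
  hodgeConjectureFor_of_isIsogenous_powSucc_of_ringHom_of_isGalois_twelve hF
    (Or.inl (exists_not_comm_of_mulEquiv_quaternionGroup e)) hXs hX6 φ h

/-- **Cyclic type `ℤ/12`.**  The Hodge conjecture for every complex abelian variety isogenous to a power of a simple
abelian sixfold with an action of a CM field `F` of degree `12` with cyclic Galois group (e.g. `ℚ(ζ₁₃)`) —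
UNCONDITIONALLY. [cite: Dodson1984, §5.3] [cite: Deligne2000, §1] -/
theorem hodgeConjectureFor_of_isIsogenous_powSucc_of_isCyclic [IsGalois ℚ F]
    (hF : Module.finrank ℚ F = 12) (hc : IsCyclic (F ≃ₐ[ℚ] F))
    {X : AbelianVariety ℂ} (hXs : X.IsSimple) (hX6 : X.dim = 6) (φ : F →+* X.endAlgebra)
    {B : AbelianVariety ℂ} {N : ℕ} (h : IsIsogenous B (X.powSucc N)) : HodgeConjectureFor B.dim B.X :=
  hodgeConjectureFor_of_isIsogenous_powSucc_of_ringHom_of_isGalois_twelve hF (Or.inr hc) hXs hX6 φ h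

/-! ### §4 Class-target displays (`HCOnClass`) -/

/-- **HC on the class «isogenous to a power of a simple abelian sixfold with an action of a Galois CM field of
degree `12` whose Galois group is non-abelian or cyclic»** (dimensions `6(N+1)`), UNCONDITIONAL — a closed class
target in the vocabulary of the `g ≤ 7` atlas. [cite: Dodson1984, §4 (p. 18) and §5.3] [cite: Deligne2000, §1] -/
theorem hcOnClass_isIsogenous_powSucc_simpleSixfold_galoisDodecicCM :
    HCOnClass fun B ↦ ∃ (X : AbelianVariety ℂ) (N : ℕ) (F : Type) (_ : Field F) (_ : NumberField F)
      (_ : IsCMField F) (_ : IsGalois ℚ F), X.IsSimple ∧ X.dim = 6 ∧ Module.finrank ℚ F = 12 ∧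
      ((∃ x y : F ≃ₐ[ℚ] F, x * y ≠ y * x) ∨ IsCyclic (F ≃ₐ[ℚ] F)) ∧
      Nonempty (F →+* X.endAlgebra) ∧ IsIsogenous B (X.powSucc N) := by
  rintro B ⟨X, N, F, _, _, _, _, hXs, hX6, hF, hG, ⟨φ⟩, h⟩
  exact hodgeConjectureFor_of_isIsogenous_powSucc_of_ringHom_of_isGalois_twelve hF hG hXs hX6 φ h

/-- **HC on the class «isogenous to a power of a simple abelian sixfold with an action of a CM field of degree `12`
without imaginary quadratic subfield»** (no Galois hypothesis), UNCONDITIONAL. [cite: Gordon1999HodgeAVSurvey, 9.4]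
[cite: Deligne2000, §1] -/
theorem hcOnClass_isIsogenous_powSucc_simpleSixfold_dodecicCM_noImaginaryQuadratic :
    HCOnClass fun B ↦ ∃ (X : AbelianVariety ℂ) (N : ℕ) (F : Type) (_ : Field F) (_ : NumberField F)
      (_ : IsCMField F), X.IsSimple ∧ X.dim = 6 ∧ Module.finrank ℚ F = 12 ∧
      (∀ k : IntermediateField ℚ F, Module.finrank ℚ k = 2 → ∀ τ : k →+* ℂ, ComplexEmbedding.conjugate τ = τ) ∧
      Nonempty (F →+* X.endAlgebra) ∧ IsIsogenous B (X.powSucc N) := by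
  rintro B ⟨X, N, F, _, _, _, hXs, hX6, hF, hreal, ⟨φ⟩, h⟩
  exact hodgeConjectureFor_of_isIsogenous_powSucc_of_ringHom_of_forall_quadratic_isReal hF hreal hXs hX6 φ h

end Summit.HodgeConjecture.CorCM.GaloisDodecic

end
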